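/-
Copyright (c) 2026 the pub-hodgecm-mathlib formalisation cell (harness21).  Prover seat hodgecm-mathlib-LH4-p19 (g0), req620 Track A «(D-RAM) FOUR-FRAME» squad
(STAGE-1b, row (2) of the piece `f_{T₊}`, the (β₂) road (R-36) «PURE-CELL LEDGER»; β₂ sub-dealer LH4-p04 (g8) BETA2-BOARD v1.1 row (L-D×) «cross-literal sign law of the
diagonal cell, `cellDiff₂(D) = −cellDiff₁(D)`»; heir LEAD F0P3a-plan (g21) T20-19 «RELATIVE SIGNS, NEVER σ(u)»), 2026-09-04.
-/
import Summits.HodgeConjecture.HodgeConjecture.Theorems.F0P3cDyRamConeCellFaceAxis       -- ★ p861154 (LH4-p15 (g0)) `valueSetMod_smul_xPlus_eq_plus_iff_exists_norm`; brings ★ `isNorm_iff_not_isNorm_div` (ConeWeightHalfSplit), ★ №3 `xPlus ∕ valueSetMod ∕ mstarOfRecord`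
import Literature.NumberTheory.LocalFields.ValuedCompleteIsAdicComplete                  -- ★ `isAdicComplete_valuedInteger_of_completeSpace`
import HarnessLib

/-!
# Crux `H413`, line LH4 «(D-RAM) FOUR-FRAME» — STAGE-1b, row (2), the (β₂) road (R-36), row (L-D×): «THE CROSS-LITERAL FACE OF THE DIAGONAL CELL» — the two literals' line
# entries `h₁ = 1 ∈ N(E^×)` and `h₂ = η ∉ N(E^×)` turn ONE letter `(f·h_W) • X₊` into OPPOSITE labels, and two cells of equal weight with opposite constant labels have
# `cellDiff₂(D) = −cellDiff₁(D)`

Cell `hodgecm-mathlib` (D-0151), FLOOR 0, crux item H413 = `stmt-HodgeConjecture-24833`, route of record `HCCMUnconditional`; squad F0∕P3c∕LH4; lane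
`--supports stmt-HodgeConjecture-24833 --as helper` (count-neutral; pays NO tier-0 row).  THEOREMS ONLY (no `def`, no instance, no notation, no `sorry`, default heartbeats);
★-only imports; states NO law; (β₂) stays a HYPOTHESIS.  DATUM-FREE (a complete sheet datum `IsRamifiedQuadraticDatum σ ϖ d t` on a valued field `K` for §1; pure indicator
algebra for §2).

WHY (sibling file `F0P3cDyRamDiagonalCellLetter`, same seat; memo `F0/P3c/LH4/LH4-p19/g0/MECH-LDx.v1.LH4p19g0.md`).  The sibling HEAD `valueSet_endoGL_sub_one_glued_eq_smul_xPlus_of_diag`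
shows that on the DIAGONAL cone cell `D` (order level = tube depth = `b`, `|lam − jE u₀₀| = |ϖ|^{2b}`, clean regime) the census letter of EVERY integral glued vertex is
`valueSetMod σ ϖ m ((f·h_W) • xPlus σ ϖ d)` — ONE `σ`-fixed unit `f` read off `lam − jE u₀₀` (LITERAL-FREE) times the LINE ENTRY `h_W` of the block form `block(H₂, h_W)`.  The two
literals of (β₂) are `block(Φ₂, 1)` (hyperbolic, `h_W = 1`) and `block(diag dg, η)` (anisotropic, `η` a `σ`-fixed NON-norm unit).  THIS FILE draws the consequence:
* §1 `exists_norm_mul_iff_of_norm`, `eq_plus_iff_of_eq_smul_mul_lineEntry`, HEAD `eq_plus_iff_not_eq_plus_of_lineEntries` — at the level of record `m* = mstarOfRecord d`, with ★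
  p861154's class dictionary (`VS_{m*}(e • X₊) = VS_{m*}(X₊) ↔ e ∈ N` for `σ`-fixed units) and index two (★ `isNorm_iff_not_isNorm_div`): `S₁ = VS(X₊) ↔ f ∈ N`,
  `S₂ = VS(X₊) ↔ f ∉ N`, hence `S₁ = VS(X₊) ↔ ¬ S₂ = VS(X₊)` — THE TWO LITERALS CARRY OPPOSITE LABELS ON `D`, whatever the (u-dependent, never computed) absolute sign `χ(f)` is.
* §2 `finsum_mem_inter_eq_ite_of_label`, HEAD `cellDiff_eq_neg_cellDiff_of_opposite_labels` — in the `cellDiff` currency of ★ p861305 §3 (`cellDiff_t(j,b) = Σᶠ_{cell ∩ q₊ᵗ} f_t −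
  Σᶠ_{cell ∩ q₋ᵗ} f_t` in `ℤ`): two cells whose WEIGHTED members carry opposite constant labels (`P₁ ↔ s`, `Q₁ ↔ ¬s`; `P₂ ↔ ¬s`, `Q₂ ↔ s`) and of equal weight
  (`Σᶠ_{D₁} f₁ = Σᶠ_{D₂} f₂` — ★ p861334 §5: both `q_E^b·q^b`) satisfy `cellDiff₂(D) = −cellDiff₁(D)`.  The sub-dealer's (L-Σ) instantiates `s := (f ∈ N(E^×))`.
WHAT IS NOT CLAIMED: the bridge from the vertex letters to the cell labels `q±ᵗ` (shell conditions at `m*`∕`m_c`, existence of the vertex over a populated `Λ` — LH4-p04 (g8)'s (S4)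
dictionaries), and the regime (small `δ`: `D` balanced∕mixed and literal-symmetric, (L-P)).
HONEST LABEL.  Count-neutral; nothing printed is asserted; no census law is stated; `HC_CM` is proved only modulo the 7 printed citations (2 remaining named inputs:
hLiu418 = `stmt-HodgeConjecture-24832`, h413 = `stmt-HodgeConjecture-24833`) until rung 0 closes.
## References
* [Serre1979] J.-P. Serre, *Local Fields*, GTM 67 (1979): Ch. V §3 Cor. 3 (norm classes of units; index two).
* [Rogawski1990] J. D. Rogawski, *Automorphic Representations of Unitary Groups in Three Variables*, Ann. of Math. Stud. 123 (1990): §4.9 Prop. 4.9.1 (b) p. 55 (the labelled census of `f_{T₊}`), §12.2.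
* [Kottwitz1986BaseChangeUnits] R. E. Kottwitz, *Base change for unit elements of Hecke algebras*, Compositio Math. 60 (1986): §1 pp. 240–241.
* [LanglandsShelstad1987] R. P. Langlands, D. Shelstad, *On the definition of transfer factors*, Math. Ann. 278 (1987): §1–§3 (κ-signs on a stable class).
-/

set_option autoImplicit false

noncomputable section

namespace Summit.HodgeConjecture.HodgeConjecture.Cruxes.H413.F0P3cDyRamDiagonalCellCrossLiteral

open scoped Valued WithZero Matrix
open WithZero
open Literature.NumberTheory.Automorphic Literature.NumberTheory.Automorphic.HermitianLattice Literature.NumberTheory.Automorphic.UnitaryLatticeTree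
open Literature.NumberTheory.Automorphic.UnitaryThreeFourFrame (IsRamifiedQuadraticDatum)
open Summit.HodgeConjecture.HodgeConjecture.Cruxes.H413.F0P3cDyRamFourFramePieces
open Summit.HodgeConjecture.HodgeConjecture.Cruxes.H413.F0P3cDyRamConeCellFaceAxis (valueSetMod_smul_xPlus_eq_plus_iff_exists_norm)
open Summit.HodgeConjecture.HodgeConjecture.Cruxes.H413.F0P3cDyRamConeWeightHalfSplit (isNorm_iff_not_isNorm_div)

/-! ## §1 The label dictionary at the level of record and the CROSS-LITERAL FACE -/

section Face

variable {K : Type} [Field K] [Valued K ℤᵐ⁰] {σ : K →+* K} {ϖ : K} {d t : ℕ}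

omit [Valued K ℤᵐ⁰] in
/-- **A NORM FACTOR DOES NOT MOVE THE CLASS**: for `h₁ = z₁σz₁`, `(∃ z, zσz = f·h₁) ↔ (∃ z, zσz = f)`. [cite: Serre1979, Ch. V §3 Cor. 3] -/
theorem exists_norm_mul_iff_of_norm (σ : K →+* K) {f h₁ : K} (hh₁0 : h₁ ≠ 0) (hh₁ : ∃ z : K, z * σ z = h₁) :
    (∃ z : K, z * σ z = f * h₁) ↔ (∃ z : K, z * σ z = f) := by
  obtain ⟨z₁, hz₁⟩ := hh₁
  have hz₁0 : z₁ ≠ 0 := fun h0 => hh₁0 (by rw [← hz₁, h0, zero_mul])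
  have hσz₁0 : σ z₁ ≠ 0 := (map_ne_zero σ).2 hz₁0
  constructor
  · rintro ⟨z, hz⟩
    refine ⟨z * z₁⁻¹, ?_⟩
    rw [map_mul, map_inv₀]
    have : z * σ z = f * (z₁ * σ z₁) := by rw [hz₁, hz]
    field_simp
    linear_combination this
  · rintro ⟨z, hz⟩
    exact ⟨z * z₁, by rw [map_mul, ← hz, ← hz₁]; ring⟩

/-- **THE CROSS-LITERAL FACE OF (L-D×).**  At a complete sheet datum `IsRamifiedQuadraticDatum σ ϖ d t` (level of record `m* = mstarOfRecord d`), for ONE `σ`-fixed unit `f` and two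
`σ`-fixed unit LINE ENTRIES `h₁ ∈ N(E^×)` (literal 1: `h₁ = 1`, the hyperbolic frame `block(Φ₂, 1)`) and `h₂ ∉ N(E^×)` (literal 2: `h₂ = η`, the anisotropic frame `block(diag dg, η)`):
if the letters of two vertices are `S₁ = VS_{m*}((f·h₁) • X₊)` and `S₂ = VS_{m*}((f·h₂) • X₊)` (the sibling HEAD `valueSet_endoGL_sub_one_glued_eq_smul_xPlus_of_diag` on the diagonal cells of the two literals), then
`S₁ = VS_{m*}(X₊) ↔ f ∈ N(E^×)` and `S₂ = VS_{m*}(X₊) ↔ f ∉ N(E^×)` — ★ p861154's class dictionary + index two (★ `isNorm_iff_not_isNorm_div`).  In particular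
`S₁ = VS_{m*}(X₊) ↔ ¬ S₂ = VS_{m*}(X₊)`: THE TWO LITERALS CARRY OPPOSITE LABELS ON THE DIAGONAL CELL. [cite: Serre1979, Ch. V §3 Cor. 3] [cite: Rogawski1990, §4.9 Prop. 4.9.1 (b) p. 55]
[cite: LanglandsShelstad1987, §1–§3] -/
theorem eq_plus_iff_of_eq_smul_mul_lineEntry [CompleteSpace K] [Finite 𝓀[K]] (hD : IsRamifiedQuadraticDatum σ ϖ d t)
    {f h₁ h₂ : K} (hσf : σ f = f) (hf1 : Valued.v f = 1) (hσh₁ : σ h₁ = h₁) (hh₁1 : Valued.v h₁ = 1) (hh₁N : ∃ z : K, z * σ z = h₁)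
    (hσh₂ : σ h₂ = h₂) (hh₂1 : Valued.v h₂ = 1) (hh₂N : ¬ ∃ z : K, z * σ z = h₂)
    {S₁ S₂ : Set K} (hS₁ : S₁ = valueSetMod σ ϖ (mstarOfRecord d) ((f * h₁) • xPlus σ ϖ d)) (hS₂ : S₂ = valueSetMod σ ϖ (mstarOfRecord d) ((f * h₂) • xPlus σ ϖ d)) :
    (S₁ = valueSetMod σ ϖ (mstarOfRecord d) (xPlus σ ϖ d) ↔ ∃ z : K, z * σ z = f) ∧
      (S₂ = valueSetMod σ ϖ (mstarOfRecord d) (xPlus σ ϖ d) ↔ ¬ ∃ z : K, z * σ z = f) := by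
  haveI := Literature.NumberTheory.LocalFields.isAdicComplete_valuedInteger_of_completeSpace (K := K) hD.2.2.1
  have hf0 : f ≠ 0 := fun h0 => by rw [h0, map_zero] at hf1; exact zero_ne_one hf1
  have hh₁0 : h₁ ≠ 0 := fun h0 => by rw [h0, map_zero] at hh₁1; exact zero_ne_one hh₁1
  have hh₂0 : h₂ ≠ 0 := fun h0 => by rw [h0, map_zero] at hh₂1; exact zero_ne_one hh₂1
  refine ⟨?_, ?_⟩
  · rw [hS₁, valueSetMod_smul_xPlus_eq_plus_iff_exists_norm hD (by rw [map_mul, hσf, hσh₁]) (by rw [Valuation.map_mul, hf1, hh₁1, mul_one])]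
    exact exists_norm_mul_iff_of_norm σ hh₁0 hh₁N
  · rw [hS₂, valueSetMod_smul_xPlus_eq_plus_iff_exists_norm hD (by rw [map_mul, hσf, hσh₂]) (by rw [Valuation.map_mul, hf1, hh₂1, mul_one]),
      isNorm_iff_not_isNorm_div hD (by rw [map_mul, hσf, hσh₂])
        (mul_ne_zero hf0 hh₂0) hσh₂ hh₂N, mul_div_cancel_right₀ f hh₂0]

/-- **OPPOSITE LABELS**, the one-line form of `eq_plus_iff_of_eq_smul_mul_lineEntry`: `S₁ = VS_{m*}(X₊) ↔ ¬ S₂ = VS_{m*}(X₊)`. [cite: Serre1979, Ch. V §3 Cor. 3] [cite: LanglandsShelstad1987, §1–§3] -/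
theorem eq_plus_iff_not_eq_plus_of_lineEntries [CompleteSpace K] [Finite 𝓀[K]] (hD : IsRamifiedQuadraticDatum σ ϖ d t)
    {f h₁ h₂ : K} (hσf : σ f = f) (hf1 : Valued.v f = 1) (hσh₁ : σ h₁ = h₁) (hh₁1 : Valued.v h₁ = 1) (hh₁N : ∃ z : K, z * σ z = h₁)
    (hσh₂ : σ h₂ = h₂) (hh₂1 : Valued.v h₂ = 1) (hh₂N : ¬ ∃ z : K, z * σ z = h₂)
    {S₁ S₂ : Set K} (hS₁ : S₁ = valueSetMod σ ϖ (mstarOfRecord d) ((f * h₁) • xPlus σ ϖ d)) (hS₂ : S₂ = valueSetMod σ ϖ (mstarOfRecord d) ((f * h₂) • xPlus σ ϖ d)) :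
    S₁ = valueSetMod σ ϖ (mstarOfRecord d) (xPlus σ ϖ d) ↔ ¬ S₂ = valueSetMod σ ϖ (mstarOfRecord d) (xPlus σ ϖ d) := by
  obtain ⟨h1, h2⟩ := eq_plus_iff_of_eq_smul_mul_lineEntry hD hσf hf1 hσh₁ hh₁1 hh₁N hσh₂ hh₂1 hh₂N hS₁ hS₂
  rw [h1, h2, not_not]

end Face

/-! ## §2 The (L-D×) indicator algebra in the `cellDiff` currency of ★ p861305 §3 -/

section Cells

variable {ι : Type*}

/-- **A CELL WITH ONE LABEL ON ITS WEIGHTED MEMBERS**: if every weighted member of `S` (`f x ≠ 0`) has `P x ↔ s`, then `Σᶠ_{S ∩ P} f = [s]·Σᶠ_S f`. [cite: Kottwitz1986BaseChangeUnits, §1 pp. 240–241] -/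
theorem finsum_mem_inter_eq_ite_of_label (S : Set ι) (P : ι → Prop) (f : ι → ℕ) (s : Prop) [Decidable s]
    (h : ∀ x ∈ S, f x ≠ 0 → (P x ↔ s)) :
    ∑ᶠ x ∈ S ∩ {x | P x}, f x = if s then ∑ᶠ x ∈ S, f x else 0 := by
  classical
  rw [finsum_mem_def, finsum_mem_def]
  split_ifs with hs
  · refine finsum_congr fun x => ?_
    by_cases hxS : x ∈ S
    · by_cases hxP : P x
      · rw [Set.indicator_of_mem (show x ∈ S ∩ {x | P x} from ⟨hxS, hxP⟩), Set.indicator_of_mem hxS]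
      · have hf0 : f x = 0 := by
          by_contra hne
          exact hxP ((h x hxS hne).2 hs)
        rw [Set.indicator_of_notMem (fun hx => hxP hx.2), Set.indicator_of_mem hxS, hf0]
    · rw [Set.indicator_of_notMem (fun hx => hxS hx.1), Set.indicator_of_notMem hxS]
  · refine (finsum_congr fun x => ?_).trans finsum_zero
    by_cases hx : x ∈ S ∩ {x | P x}
    · have hf0 : f x = 0 := by
        by_contra hne
        exact hs ((h x hx.1 hne).1 hx.2)
      rw [Set.indicator_of_mem hx, hf0]
    · rw [Set.indicator_of_notMem hx]

/-- **(L-D×) IN THE `cellDiff` CURRENCY — TWO PURE CELLS OF EQUAL WEIGHT AND OPPOSITE CONSTANT LABEL.**  Cells `D₁, D₂` (the diagonal cells of the two literals) with weights `f₁, f₂`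
and labels `(P₁, Q₁)`, `(P₂, Q₂)` (= `(q₊, q₋)` of ★ p861305 §3); if ONE proposition `s` (= «`f ∈ N(E^×)`» of §1) labels every weighted member — literal 1: `P₁ ↔ s`, `Q₁ ↔ ¬s`;
literal 2: `P₂ ↔ ¬s`, `Q₂ ↔ s` — and the cells have equal weight (`Σᶠ_{D₁} f₁ = Σᶠ_{D₂} f₂`, ★ p861334 §5: both `q_E^b·q^b`), then
`cellDiff₂(D) = −cellDiff₁(D)`:  `(Σᶠ_{D₂ ∩ P₂} f₂ − Σᶠ_{D₂ ∩ Q₂} f₂) = −(Σᶠ_{D₁ ∩ P₁} f₁ − Σᶠ_{D₁ ∩ Q₁} f₁)` in `ℤ`. [cite: Kottwitz1986BaseChangeUnits, §1 pp. 240–241]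
[cite: Rogawski1990, §4.9 Prop. 4.9.1 (b) p. 55] [cite: LanglandsShelstad1987, §1–§3] -/
theorem cellDiff_eq_neg_cellDiff_of_opposite_labels (D₁ D₂ : Set ι) (f₁ f₂ : ι → ℕ) (P₁ Q₁ P₂ Q₂ : ι → Prop) (s : Prop)
    (h₁ : ∀ Λ ∈ D₁, f₁ Λ ≠ 0 → (P₁ Λ ↔ s) ∧ (Q₁ Λ ↔ ¬ s)) (h₂ : ∀ Λ ∈ D₂, f₂ Λ ≠ 0 → (P₂ Λ ↔ ¬ s) ∧ (Q₂ Λ ↔ s))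
    (hsize : ∑ᶠ Λ ∈ D₁, f₁ Λ = ∑ᶠ Λ ∈ D₂, f₂ Λ) :
    ((∑ᶠ Λ ∈ D₂ ∩ {Λ | P₂ Λ}, f₂ Λ : ℕ) : ℤ) - ((∑ᶠ Λ ∈ D₂ ∩ {Λ | Q₂ Λ}, f₂ Λ : ℕ) : ℤ) =
      -(((∑ᶠ Λ ∈ D₁ ∩ {Λ | P₁ Λ}, f₁ Λ : ℕ) : ℤ) - ((∑ᶠ Λ ∈ D₁ ∩ {Λ | Q₁ Λ}, f₁ Λ : ℕ) : ℤ)) := by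
  classical
  rw [finsum_mem_inter_eq_ite_of_label D₁ P₁ f₁ s (fun x hx hf => (h₁ x hx hf).1),
    finsum_mem_inter_eq_ite_of_label D₁ Q₁ f₁ (¬ s) (fun x hx hf => (h₁ x hx hf).2),
    finsum_mem_inter_eq_ite_of_label D₂ P₂ f₂ (¬ s) (fun x hx hf => (h₂ x hx hf).1),
    finsum_mem_inter_eq_ite_of_label D₂ Q₂ f₂ s (fun x hx hf => (h₂ x hx hf).2), hsize]
  by_cases hs : s
  · simp [hs]
  · simp [hs]

end Cells

end Summit.HodgeConjecture.HodgeConjecture.Cruxes.H413.F0P3cDyRamDiagonalCellCrossLiteral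

end
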